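/-
Copyright: b2b-lace cell (CriticalPhenomena). Text-final: lean1-g50 desk draft 2 (6630641340fd5f01) + header relabel ∕ (r2), filed by
lean1-g51 under REFEREE v219 R1416 (T3 booking; ORDERS v221 (b)) after T1 `NobleWeightedDiagSplit` (c11638786dac7132) landed;
diagonal normal forms, product bounds `𝓣 ≤ 𝓣*`, direction transport; no numeral; d-generic; no cited hypothesis.
-/
import Literature.Probability.FitznerVanDerHofstad2017.NobleWeightedDiagSplit
import Literature.Probability.FitznerVanDerHofstad2017.NobleEntryAbarIotaZeroTwoLower
import Literature.Probability.FitznerVanDerHofstad2017.NobleGapSliceSymm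
import Literature.Probability.FitznerVanDerHofstad2017.NoblePercLettersSymm
import HarnessLib

/-!
# [FvdH17] Lemma 5.1 (second version), right-trivial configurations: the DIAGONAL `x = w` (classes `a = 1, 2`) — normal forms, product bounds, transport over the directions

CITATION HEADER (PLACEMENT v2). This module is part of a certified REPRODUCTION of:
R. Fitzner, R. van der Hofstad, *Mean-field behavior for nearest-neighbor percolation in `d > 10`*, Electron. J.
Probab. **22** (2017) no. 43 [FvdH17] (arXiv:1506.07977v2): §4.4 (4.65) (p. 43), Lemma 5.1 second version (p. 50),
§4.2 (4.8), (4.14)–(4.17) (pp. 34–36: the product bounds `𝓣 ≤ 𝓣*`), §3.5 "Symmetry of the model" (p. 32), App. B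
Tables "definition of `P^b(x,y)`" (p. 73), "definition of `A^{ι,a,b}`" (p. 75) and "`Ā^{ι,a,b}`" (p. 78).  Origin: build
`lace` (host summit CriticalPhenomena), LEAN TYPING SEAT 1; node N76, booking T3 (REFEREE v219 R1416), pieces R-c ∕ R-d
of the LEAD's DEDICATED-CELLS SPEC v58 §1.

WHAT THIS FILE DOES.  `rawRDiag Sn Ab ι a = Σ_{u,w} ‖w‖₂² (1−δ_{w,0}) Sn_a(u,w) Ab^{ι,a,0}(u,w,w,w)`
(`NobleWeightedDiagSplit`) is the diagonal `x = w` of the `w ≠ 0` part of the right-trivial sum `R_R(ι,a)` of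
`NobleWeightedN1Assembly` (D98-neutral: it is one ADDEND of the split identity `rawRPieceOff0 = rawRDiag + rawROffDiag`;
no bound on a whole piece is asserted here).  For the tabulated families `Sn = blockPSn L`
(Table `P^b`: row `b = 1`, the start letter `𝓣_{1,1̲,1}(u,w,0)` whose middle line is an EXACT BOND; row `b ≥ 2`, the
closed start triangle `𝓣_{1,2,1}(u,w,0)`) and `Ab = blockAbar' L` (Table `A^{ι,a,b}`, rows `(1,0)` ∕ `(a ≥ 2, 0)`:
`δ_{x,y} (1−δ_{x,0}) 2dD(v) 𝓣_{1̲,1,0}(e_ι,x,v)` ∕ `δ_{x,y} 𝓣_{1̲,1,0}(e_ι,x,v)`, read at the diagonal `v = x = y`):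
* LETTERS (every letter table `L`): the one-bond letter `K^ι_L(y) := 𝓣_{1̲,1,0}(e_ι,y,y)` (`diagKLetter`) and its sum
  over the `2d` directions `K̄_L(y) := Σ_ι K^ι_L(y)` (`diagKbar`); the weighted start letters at middle displacement `y`,
  `WTB_L(y) := Σ_w ‖w‖₂² (1−δ_{w,0})(1−δ_{w−y,0}) 𝓣_{1,1̲,1}(w−y,w,0)` (`diagWTB`, class `1`) and
  `WTT_L(y) := Σ_w ‖w‖₂² (1−δ_{w,0})(1−δ_{w−y,0}) 𝓣_{1,2,1}(w−y,w,0)` (`diagWTT`, class `2`); the pointwise weighted open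
  bubble `Φ_L(y) := Σ_w ‖w‖₂² τ₁(w) τ₁(w−y)` (`wtOpenBubbleAt`).
* NORMAL FORMS (identities, every `L`; reindexing `y := w − u`): `rawRDiag (blockPSn L) (blockAbar' L) ι 2 =
  Σ_y K^ι_L(y) WTT_L(y)` (`rawRDiag_two_eq`), `Σ_ι … ι 2 = Σ_y K̄_L(y) WTT_L(y)` (`sum_rawRDiag_two_eq`);
  `rawRDiag (blockPSn L) (blockAbar' L) ι 1 = Σ_y (1−δ_{y,0}) 2dD(y) K^ι_L(y) WTB_L(y)` (`rawRDiag_one_eq`) and, the factor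
  `2dD(y)` restricting `y` to the unit vectors, `Σ_ι … ι 1 = Σ_κ K̄_L(e_κ) WTB_L(e_κ)` (`sum_rawRDiag_one_eq_sum_stepVec`).
  The sums are over ALL `y` (no `(1−δ_{u,w})` in the tabulated integrands).
* PRODUCT BOUNDS at `L = Letters.perc d p` ((4.14)–(4.17), `𝓣 ≤ 𝓣*`; exact bond `τ_{1̲}(e_ι) = p`; trivial line
  `τ_{≥0}(0) = 1`; reflection `τ_j(−x) = τ_j(x)`): `K^ι(y) ≤ p τ₁(y − e_ι)`, `K̄(y) ≤ p Σ_ι τ₁(y − e_ι)`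
  (`perc_diagKLetter_le`, `perc_diagKbar_le`); `WT_j(y) ≤ τ_j(y) Φ(y)` for both start letters (`perc_diagWTB_le`,
  `perc_diagWTT_le`; the weighted line is the start letter's third side `w → 0`), `WTB(e_κ) ≤ p Φ(e_κ)`
  (`perc_diagWTB_stepVec_le`).
* TRANSPORT over the `2d` directions (§3.5, `W_d`-invariance of `P_p`; `NoblePercLettersSymm`): `K̄`, `WTB`, `τ_j`, `Φ`
  are `W_d`-invariant, hence for every direction `ι₀`
  `Σ_ι rawRDiag … ι 1 = 2d · K̄(e_{ι₀}) · WTB(e_{ι₀}) ≤ 2d · (p Σ_ι τ₁(e_{ι₀} − e_ι)) · (p Φ(e_{ι₀}))`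
  (`perc_sum_rawRDiag_one_eq`, `perc_sum_rawRDiag_one_le`) and
  `Σ_ι rawRDiag … ι 2 ≤ p Σ_y (Σ_ι τ₁(y − e_ι)) τ₂(y) Φ(y) = p · 2d · Σ_y τ₁(y − e_{ι₀}) τ₂(y) Φ(y)`
  (`perc_sum_rawRDiag_two_le`, `perc_tsum_sum_tau_sub_stepVec_mul_eq`, `perc_sum_rawRDiag_two_le_dir`).
INDEX PLACEMENT (left open by the tables): the start letter's middle index (`1̲` ∕ `≥2`) sits on the displacement
`y = w − u`, which is also the end point of the one-bond letter's `≥1` line `e_ι → y`; `Φ`'s two lines are the start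
letter's sides `0 → u` and `w → 0` (the latter weighted).  No inequality between different letters of print is asserted
beyond `𝓣 ≤ 𝓣*`; no numeral; nothing landed is modified; no cited hypothesis.
-/

noncomputable section

namespace Literature.Probability.FitznerVanDerHofstad2017

open scoped BigOperators ENNReal
open Literature.Probability.LatticeModels Literature.Probability.Percolation
open Literature.Probability.FitznerVanDerHofstad2017.BlockSummation
open Literature.Probability.FitznerVanDerHofstad2017.NobleBlocks

variable {d : ℕ}

/-! ## A. The letters at the diagonal and the class-`2` normal form (every letter table `L`) -/

/-- **The one-bond letter of the right-trivial diagonal**: `K^ι_L(y) := 𝓣_{1̲,1,0}(e_ι, y, y)` — row `(a,0)`, `a ≥ 2`,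
of Table `Ā^{ι,a,b}` (`δ_{x,y} 𝓣_{1̲,1,0}(e_ι,x,v)`) read at `x = v = y`: the pivotal bond `0 → e_ι`, a line
`e_ι → y`, and a trivial point-to-itself third line.
[cite: FitznerVanDerHofstad2017, App. B Table "definition of A^{ι,a,b}", row a ≥ 2, b = 0 (arXiv:1506.07977v2 p. 75); display "Ā^{ι,a,0} = A^{ι,a,0}" (p. 78)] -/
def diagKLetter (L : Letters d) (ι : Fin d × Bool) (y : Site d) : ℝ≥0∞ :=
  L.T (.eq 1) (.ge 1) (.ge 0) (stepVec ι) y y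

/-- **`K̄_L(y) := Σ_ι K^ι_L(y)`** — the one-bond letter summed over the `2d` directions of the pivotal bond.
[cite: FitznerVanDerHofstad2017, App. B Table "definition of A^{ι,a,b}", row a ≥ 2, b = 0 (arXiv:1506.07977v2 p. 75); §4.4 (4.65), the sum over ι (p. 43)] -/
def diagKbar (L : Letters d) (y : Site d) : ℝ≥0∞ :=
  ∑ ι : Fin d × Bool, diagKLetter L ι y

/-- **The weighted closed class-`2` start triangle at middle displacement `y`**:
`WTT_L(y) := Σ_w ‖w‖₂² (1−δ_{w,0}) (1−δ_{w−y,0}) 𝓣_{1,2,1}(w−y, w, 0)` (Table `P^b`, row `b ≥ 2`, `y ≠ 0`, at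
`(x,y) = (w−y, w)`, weight on the vertex `w`).
[cite: FitznerVanDerHofstad2017, App. B Table "definition of P^b(x,y)", row b ≥ 2 (arXiv:1506.07977v2 p. 73); Lemma 5.1 second version (p. 50)] -/
def diagWTT (L : Letters d) (y : Site d) : ℝ≥0∞ :=
  ∑' w, wt w * (kdc w 0 * (kdc (w - y) 0 * L.T (.ge 1) (.ge 2) (.ge 1) (w - y) w 0))

/-- **The weighted class-`1` start letter at middle displacement `y`**:
`WTB_L(y) := Σ_w ‖w‖₂² (1−δ_{w,0}) (1−δ_{w−y,0}) 𝓣_{1,1̲,1}(w−y, w, 0)` (Table `P^b`, row `b = 1`, `y ≠ 0`, at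
`(x,y) = (w−y, w)`: the middle line is the EXACT BOND `w−y → w`, weight on the vertex `w`).
[cite: FitznerVanDerHofstad2017, App. B Table "definition of P^b(x,y)", row b = 1 (arXiv:1506.07977v2 p. 73); Lemma 5.1 second version (p. 50)] -/
def diagWTB (L : Letters d) (y : Site d) : ℝ≥0∞ :=
  ∑' w, wt w * (kdc w 0 * (kdc (w - y) 0 * L.T (.ge 1) (.eq 1) (.ge 1) (w - y) w 0))

/-- **The pointwise weighted open bubble** `Φ_L(y) := Σ_w ‖w‖₂² τ₁(w) τ₁(w − y)`.
[cite: FitznerVanDerHofstad2017, §5.1 "Elements of the bounds", weighted open bubble (arXiv:1506.07977v2 p. 49); App. B "Building blocks with weight" (p. 78)] -/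
def wtOpenBubbleAt (L : Letters d) (y : Site d) : ℝ≥0∞ :=
  ∑' w, wt w * (L.tau (.ge 1) w * L.tau (.ge 1) (w - y))

/-- Under `w ≠ 0` the class-`2` start letter is the closed triangle: `(1−δ_{w,0}) (P^S−u⃗)_2(u,w) =
(1−δ_{w,0})(1−δ_{u,0}) 𝓣_{1,2,1}(u,w,0)` (the `δ_{w,0} 𝓓_{2,2}(u)` addend of row `b ≥ 2` is killed).
[cite: FitznerVanDerHofstad2017, App. B Table "definition of P^b(x,y)", row b ≥ 2 (arXiv:1506.07977v2 p. 73)] -/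
theorem kdc_mul_blockPSn_two (L : Letters d) (u w : Site d) :
    kdc w 0 * blockPSn L 2 u w = kdc w 0 * (kdc u 0 * L.T (.ge 1) (.ge 2) (.ge 1) u w 0) := by
  by_cases hw : w = 0
  · subst hw
    rw [kdc_self, zero_mul, zero_mul]
  · have h2 : blockPSn L 2 u w
        = kdc u 0 * (kd w 0 * L.D (.ge 2) (.ge 2) u + kdc w 0 * L.T (.ge 1) (.ge 2) (.ge 1) u w 0) := rfl
    rw [h2, kd_of_ne hw, kdc_of_ne hw]
    ring

/-- Row `(2,0)` of `Ā^ι` at the diagonal: `Ā^{ι,2,0}(u,w,w,w) = 𝓣_{1̲,1,0}(e_ι, w−u, w−u) = K^ι_L(w − u)`.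
[cite: FitznerVanDerHofstad2017, App. B Table "definition of A^{ι,a,b}", row a ≥ 2, b = 0 (arXiv:1506.07977v2 p. 75); display "Ā^{ι,a,0} = A^{ι,a,0}" (p. 78)] -/
theorem blockAbar'_two_zero_diag (L : Letters d) (ι : Fin d × Bool) (u w : Site d) :
    blockAbar' L ι 2 0 u w w w = diagKLetter L ι (w - u) := by
  simp [blockAbar', ofBase, blockAbar₀', blockAbar₀, blockAiota₀, diagKLetter]

/-- The integrand of `rawRDiag … ι 2` at `(u,w)`: `‖w‖₂² (1−δ_{w,0}) (P^S−u⃗)_2(u,w) Ā^{ι,2,0}(u,w,w,w)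
= K^ι_L(w−u) · ‖w‖₂² (1−δ_{w,0})(1−δ_{u,0}) 𝓣_{1,2,1}(u,w,0)`.
[cite: FitznerVanDerHofstad2017, App. B Tables "definition of P^b(x,y)" (arXiv:1506.07977v2 p. 73) and "Ā^{ι,a,b}" (p. 78); Lemma 5.1 second version (p. 50)] -/
theorem rawRDiag_two_integrand (L : Letters d) (ι : Fin d × Bool) (u w : Site d) :
    wt w * (kdc w 0 * (blockPSn L 2 u w * blockAbar' L ι 2 0 u w w w))
      = diagKLetter L ι (w - u) * (wt w * (kdc w 0 * (kdc u 0 * L.T (.ge 1) (.ge 2) (.ge 1) u w 0))) := by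
  rw [blockAbar'_two_zero_diag]
  calc wt w * (kdc w 0 * (blockPSn L 2 u w * diagKLetter L ι (w - u)))
        = wt w * ((kdc w 0 * blockPSn L 2 u w) * diagKLetter L ι (w - u)) := by ring
    _ = wt w * ((kdc w 0 * (kdc u 0 * L.T (.ge 1) (.ge 2) (.ge 1) u w 0)) * diagKLetter L ι (w - u)) := by
          rw [kdc_mul_blockPSn_two]
    _ = diagKLetter L ι (w - u) * (wt w * (kdc w 0 * (kdc u 0 * L.T (.ge 1) (.ge 2) (.ge 1) u w 0))) := by ring

/-- **Normal form of the class-`2` right-trivial diagonal** (an identity, every letter table): reindexing the start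
triangle's first vertex as `u = w − y`,
`rawRDiag (blockPSn L) (blockAbar' L) ι 2 = Σ_y K^ι_L(y) · WTT_L(y)`.
[cite: FitznerVanDerHofstad2017, §4.4 (4.65) (arXiv:1506.07977v2 p. 43); Lemma 5.1 second version (p. 50); App. B Tables pp. 73, 78] -/
theorem rawRDiag_two_eq (L : Letters d) (ι : Fin d × Bool) :
    rawRDiag (blockPSn L) (blockAbar' L) ι 2 = ∑' y, diagKLetter L ι y * diagWTT L y := by
  unfold rawRDiag
  simp_rw [rawRDiag_two_integrand]
  rw [ENNReal.tsum_comm]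
  have h : ∀ w : Site d,
      ∑' u, diagKLetter L ι (w - u) * (wt w * (kdc w 0 * (kdc u 0 * L.T (.ge 1) (.ge 2) (.ge 1) u w 0)))
        = ∑' y, diagKLetter L ι y * (wt w * (kdc w 0 * (kdc (w - y) 0 * L.T (.ge 1) (.ge 2) (.ge 1) (w - y) w 0))) := by
    intro w
    rw [← (Equiv.subLeft w).tsum_eq]
    simp only [Equiv.subLeft_apply, sub_sub_cancel]
  simp_rw [h]
  rw [ENNReal.tsum_comm]
  refine tsum_congr fun y => ?_
  rw [diagWTT, ← ENNReal.tsum_mul_left]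

/-- **Summed over the `2d` directions**: `Σ_ι rawRDiag (blockPSn L) (blockAbar' L) ι 2 = Σ_y K̄_L(y) · WTT_L(y)`.
[cite: FitznerVanDerHofstad2017, §4.4 (4.65) (arXiv:1506.07977v2 p. 43); Lemma 5.1 second version (p. 50)] -/
theorem sum_rawRDiag_two_eq (L : Letters d) :
    ∑ ι : Fin d × Bool, rawRDiag (blockPSn L) (blockAbar' L) ι 2
      = ∑' y, diagKbar L y * diagWTT L y := by
  simp_rw [rawRDiag_two_eq]
  rw [← tsum_finsetSum]
  exact tsum_congr fun y => (Finset.sum_mul _ _ _).symm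

/-! ## A′. Class `a = 1`: the same unfolding one class down (the start letter's middle line an exact bond) -/

/-- Under `w ≠ 0` the class-`1` start letter is `(1−δ_{w,0})(1−δ_{u,0}) 𝓣_{1,1̲,1}(u,w,0)` (the `δ_{w,0} 𝓑_{3,1̲}(u,0)`
addend of row `b = 1` is killed).
[cite: FitznerVanDerHofstad2017, App. B Table "definition of P^b(x,y)", row b = 1 (arXiv:1506.07977v2 p. 73)] -/
theorem kdc_mul_blockPSn_one (L : Letters d) (u w : Site d) :
    kdc w 0 * blockPSn L 1 u w = kdc w 0 * (kdc u 0 * L.T (.ge 1) (.eq 1) (.ge 1) u w 0) := by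
  by_cases hw : w = 0
  · subst hw
    rw [kdc_self, zero_mul, zero_mul]
  · have h1 : blockPSn L 1 u w
        = kdc u 0 * (kd w 0 * L.B (.ge 3) (.eq 1) u 0 + kdc w 0 * L.T (.ge 1) (.eq 1) (.ge 1) u w 0) := rfl
    rw [h1, kd_of_ne hw, kdc_of_ne hw]
    ring

/-- Row `(1,0)` of `Ā^ι` at the diagonal: `Ā^{ι,1,0}(u,w,w,w) = (1−δ_{w−u,0}) 2dD(w−u) 𝓣_{1̲,1,0}(e_ι, w−u, w−u)`.
[cite: FitznerVanDerHofstad2017, App. B Table "definition of A^{ι,a,b}", row a = 1, b = 0 (arXiv:1506.07977v2 p. 75); display "Ā^{ι,a,0} = A^{ι,a,0}" (p. 78)] -/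
theorem blockAbar'_one_zero_diag (L : Letters d) (ι : Fin d × Bool) (u w : Site d) :
    blockAbar' L ι 1 0 u w w w = kdc (w - u) 0 * twoDD (w - u) * diagKLetter L ι (w - u) := by
  simp [blockAbar', ofBase, blockAbar₀', blockAbar₀, blockAiota₀, diagKLetter]

/-- The integrand of `rawRDiag … ι 1` at `(u,w)`.
[cite: FitznerVanDerHofstad2017, App. B Tables "definition of P^b(x,y)" (arXiv:1506.07977v2 p. 73) and "Ā^{ι,a,b}" (p. 78); Lemma 5.1 second version (p. 50)] -/
theorem rawRDiag_one_integrand (L : Letters d) (ι : Fin d × Bool) (u w : Site d) :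
    wt w * (kdc w 0 * (blockPSn L 1 u w * blockAbar' L ι 1 0 u w w w))
      = (kdc (w - u) 0 * twoDD (w - u) * diagKLetter L ι (w - u))
          * (wt w * (kdc w 0 * (kdc u 0 * L.T (.ge 1) (.eq 1) (.ge 1) u w 0))) := by
  rw [blockAbar'_one_zero_diag]
  calc wt w * (kdc w 0 * (blockPSn L 1 u w * (kdc (w - u) 0 * twoDD (w - u) * diagKLetter L ι (w - u))))
        = wt w * ((kdc w 0 * blockPSn L 1 u w) * (kdc (w - u) 0 * twoDD (w - u) * diagKLetter L ι (w - u))) := by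
          ring
    _ = wt w * ((kdc w 0 * (kdc u 0 * L.T (.ge 1) (.eq 1) (.ge 1) u w 0))
          * (kdc (w - u) 0 * twoDD (w - u) * diagKLetter L ι (w - u))) := by rw [kdc_mul_blockPSn_one]
    _ = (kdc (w - u) 0 * twoDD (w - u) * diagKLetter L ι (w - u))
          * (wt w * (kdc w 0 * (kdc u 0 * L.T (.ge 1) (.eq 1) (.ge 1) u w 0))) := by ring

/-- **Normal form of the class-`1` right-trivial diagonal** (an identity, every letter table):
`rawRDiag (blockPSn L) (blockAbar' L) ι 1 = Σ_y (1−δ_{y,0}) 2dD(y) K^ι_L(y) · WTB_L(y)`.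
[cite: FitznerVanDerHofstad2017, §4.4 (4.65) (arXiv:1506.07977v2 p. 43); Lemma 5.1 second version (p. 50); App. B Tables pp. 73, 75, 78] -/
theorem rawRDiag_one_eq (L : Letters d) (ι : Fin d × Bool) :
    rawRDiag (blockPSn L) (blockAbar' L) ι 1
      = ∑' y, (kdc y 0 * twoDD y * diagKLetter L ι y) * diagWTB L y := by
  unfold rawRDiag
  simp_rw [rawRDiag_one_integrand]
  rw [ENNReal.tsum_comm]
  have h : ∀ w : Site d,
      ∑' u, (kdc (w - u) 0 * twoDD (w - u) * diagKLetter L ι (w - u))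
          * (wt w * (kdc w 0 * (kdc u 0 * L.T (.ge 1) (.eq 1) (.ge 1) u w 0)))
        = ∑' y, (kdc y 0 * twoDD y * diagKLetter L ι y)
          * (wt w * (kdc w 0 * (kdc (w - y) 0 * L.T (.ge 1) (.eq 1) (.ge 1) (w - y) w 0))) := by
    intro w
    rw [← (Equiv.subLeft w).tsum_eq]
    simp only [Equiv.subLeft_apply, sub_sub_cancel]
  simp_rw [h]
  rw [ENNReal.tsum_comm]
  refine tsum_congr fun y => ?_
  rw [diagWTB, ← ENNReal.tsum_mul_left]

/-- Summed over the `2d` directions of the pivotal bond: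
`Σ_ι rawRDiag (blockPSn L) (blockAbar' L) ι 1 = Σ_y (1−δ_{y,0}) 2dD(y) K̄_L(y) · WTB_L(y)`.
[cite: FitznerVanDerHofstad2017, §4.4 (4.65) (arXiv:1506.07977v2 p. 43); Lemma 5.1 second version (p. 50)] -/
theorem sum_rawRDiag_one_eq (L : Letters d) :
    ∑ ι : Fin d × Bool, rawRDiag (blockPSn L) (blockAbar' L) ι 1
      = ∑' y, (kdc y 0 * twoDD y * diagKbar L y) * diagWTB L y := by
  simp_rw [rawRDiag_one_eq]
  rw [← tsum_finsetSum]
  refine tsum_congr fun y => ?_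
  rw [← Finset.sum_mul, diagKbar, Finset.mul_sum]

/-- **The class-`1` right-trivial diagonal lives on the unit vectors** (the factor `2dD(y)`): for every letter table,
`Σ_ι rawRDiag (blockPSn L) (blockAbar' L) ι 1 = Σ_κ K̄_L(e_κ) · WTB_L(e_κ)`.
[cite: FitznerVanDerHofstad2017, §6.1 "Case a = 1" ("u and w are neighbors, 2dD(u−w) = 1") (arXiv:1506.07977v2 p. 59); Lemma 5.1 second version (p. 50)] -/
theorem sum_rawRDiag_one_eq_sum_stepVec (L : Letters d) :
    ∑ ι : Fin d × Bool, rawRDiag (blockPSn L) (blockAbar' L) ι 1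
      = ∑ κ : Fin d × Bool, diagKbar L (stepVec κ) * diagWTB L (stepVec κ) := by
  rw [sum_rawRDiag_one_eq, tsum_eq_sum_stepVec_of_eq_zero (F := fun y : Site d =>
    (kdc y 0 * twoDD y * diagKbar L y) * diagWTB L y) fun y hy => by
      simp only [twoDD_of_not_mem_unitVecs hy, mul_zero, zero_mul]]
  refine Finset.sum_congr rfl fun κ _ => ?_
  simp only [kdc_of_ne (stepVec_ne_zero_site κ), twoDD_stepVec, one_mul]

/-! ## B. Product bounds at `Letters.perc d p` -/

section Perc

variable (p : unitInterval)

/-- `τ_j(−x) = τ_j(x)` for every restricted two-point letter (point reflection `x ↦ −x` is the signed coordinate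
permutation `(id, −1)` of `W_d`).
[cite: FitznerVanDerHofstad2017, §3.5 "Symmetry of the model" (arXiv:1506.07977v2 p. 32); §4.2 (4.1) (p. 34)] -/
theorem perc_tau_neg (j : LenIdx) (x : Site d) :
    (Letters.perc d p).tau j (-x) = (Letters.perc d p).tau j x := by
  have h : Site.signedPerm (Equiv.refl (Fin d)) (fun _ => -1) x = -x := by
    ext i
    simp [Site.signedPerm_apply]
  rw [← h, perc_tau_signedPerm]

/-- **The one-bond letter, product-bounded**: `K^ι(y) = 𝓣_{1̲,1,0}(e_ι,y,y) ≤ τ_{1̲}(e_ι) τ₁(y − e_ι) τ_{≥0}(0)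
= p · τ₁(y − e_ι)` (`𝓣 ≤ 𝓣*`; the exact bond; the trivial third line).
[cite: FitznerVanDerHofstad2017, §4.2 (4.8), (4.14)–(4.17) (arXiv:1506.07977v2 pp. 34–36); App. B Table "definition of A^{ι,a,b}", row a ≥ 2, b = 0 (p. 75)] -/
theorem perc_diagKLetter_le (ι : Fin d × Bool) (y : Site d) :
    diagKLetter (Letters.perc d p) ι y
      ≤ ENNReal.ofReal p * (Letters.perc d p).tau (.ge 1) (y - stepVec ι) := by
  unfold diagKLetter
  refine (perc_T_le_Tst p _ _ _ _ _ _).trans_eq ?_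
  simp only [Letters.Tst, Letters.Bst, sub_self, perc_tau_eq_one_stepVec, perc_tau_ge_zero_zero, mul_one]

/-- **`K̄(y) ≤ p · Σ_ι τ₁(y − e_ι)`**.
[cite: FitznerVanDerHofstad2017, §4.2 (4.8), (4.14)–(4.17) (arXiv:1506.07977v2 pp. 34–36); App. B Table "definition of A^{ι,a,b}", row a ≥ 2, b = 0 (p. 75)] -/
theorem perc_diagKbar_le (y : Site d) :
    diagKbar (Letters.perc d p) y
      ≤ ENNReal.ofReal p * ∑ ι : Fin d × Bool, (Letters.perc d p).tau (.ge 1) (y - stepVec ι) := by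
  rw [diagKbar, Finset.mul_sum]
  exact Finset.sum_le_sum fun ι _ => perc_diagKLetter_le p ι y

/-- The integrand of the weighted start letters, product-bounded (any middle index `j`):
`‖w‖₂² (1−δ_{w,0})(1−δ_{w−y,0}) 𝓣_{1,j,1}(w−y,w,0) ≤ τ_j(y) · ‖w‖₂² τ₁(w) τ₁(w − y)`
(`𝓣 ≤ 𝓣* = τ₁(w−y) τ_j(y) τ₁(−w)`, `τ₁(−w) = τ₁(w)`).
[cite: FitznerVanDerHofstad2017, §4.2 (4.8), (4.14)–(4.17) (arXiv:1506.07977v2 pp. 34–36); App. B Table "definition of P^b(x,y)", rows b = 1, b ≥ 2 (p. 73)] -/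
theorem perc_wt_startLetter_integrand_le (j : LenIdx) (y w : Site d) :
    wt w * (kdc w 0 * (kdc (w - y) 0 * (Letters.perc d p).T (.ge 1) j (.ge 1) (w - y) w 0))
      ≤ (Letters.perc d p).tau j y
          * (wt w * ((Letters.perc d p).tau (.ge 1) w * (Letters.perc d p).tau (.ge 1) (w - y))) := by
  have hT : (Letters.perc d p).T (.ge 1) j (.ge 1) (w - y) w 0
      ≤ (Letters.perc d p).tau (.ge 1) (w - y) * (Letters.perc d p).tau j y
          * (Letters.perc d p).tau (.ge 1) (-w) := by
    refine (perc_T_le_Tst p _ _ _ _ _ _).trans_eq ?_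
    simp only [Letters.Tst, Letters.Bst, sub_sub_cancel, zero_sub]
  have hk : kdc w 0 * (kdc (w - y) 0 * (Letters.perc d p).T (.ge 1) j (.ge 1) (w - y) w 0)
      ≤ (Letters.perc d p).T (.ge 1) j (.ge 1) (w - y) w 0 := by
    calc kdc w 0 * (kdc (w - y) 0 * (Letters.perc d p).T (.ge 1) j (.ge 1) (w - y) w 0)
          ≤ 1 * (1 * (Letters.perc d p).T (.ge 1) j (.ge 1) (w - y) w 0) :=
            mul_le_mul' (kdc_le_one _ _) (mul_le_mul' (kdc_le_one _ _) le_rfl)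
      _ = (Letters.perc d p).T (.ge 1) j (.ge 1) (w - y) w 0 := by rw [one_mul, one_mul]
  calc wt w * (kdc w 0 * (kdc (w - y) 0 * (Letters.perc d p).T (.ge 1) j (.ge 1) (w - y) w 0))
        ≤ wt w * ((Letters.perc d p).tau (.ge 1) (w - y) * (Letters.perc d p).tau j y
            * (Letters.perc d p).tau (.ge 1) (-w)) := mul_le_mul' le_rfl (hk.trans hT)
    _ = (Letters.perc d p).tau j y
          * (wt w * ((Letters.perc d p).tau (.ge 1) w * (Letters.perc d p).tau (.ge 1) (w - y))) := by
          rw [perc_tau_neg]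
          ring

/-- **The weighted closed start triangle, product-bounded**: `WTT(y) ≤ τ₂(y) · Φ(y)`.
[cite: FitznerVanDerHofstad2017, §4.2 (4.14)–(4.17) (arXiv:1506.07977v2 pp. 35–36); Lemma 5.1 second version (p. 50); App. B "Building blocks with weight" (p. 78)] -/
theorem perc_diagWTT_le (y : Site d) :
    diagWTT (Letters.perc d p) y ≤ (Letters.perc d p).tau (.ge 2) y * wtOpenBubbleAt (Letters.perc d p) y := by
  unfold diagWTT wtOpenBubbleAt
  rw [← ENNReal.tsum_mul_left]
  exact ENNReal.tsum_le_tsum fun w => perc_wt_startLetter_integrand_le p (.ge 2) y w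

/-- **The weighted class-`1` start letter, product-bounded**: `WTB(y) ≤ τ_{1̲}(y) · Φ(y)`.
[cite: FitznerVanDerHofstad2017, §4.2 (4.14)–(4.17) (arXiv:1506.07977v2 pp. 35–36); Lemma 5.1 second version (p. 50); App. B "Building blocks with weight" (p. 78)] -/
theorem perc_diagWTB_le (y : Site d) :
    diagWTB (Letters.perc d p) y ≤ (Letters.perc d p).tau (.eq 1) y * wtOpenBubbleAt (Letters.perc d p) y := by
  unfold diagWTB wtOpenBubbleAt
  rw [← ENNReal.tsum_mul_left]
  exact ENNReal.tsum_le_tsum fun w => perc_wt_startLetter_integrand_le p (.eq 1) y w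

/-- **At a unit vector the exact bond is the factor `p`**: `WTB(e_κ) ≤ p · Φ(e_κ)`.
[cite: FitznerVanDerHofstad2017, §4.2 (4.8) (arXiv:1506.07977v2 p. 34); Lemma 5.1 second version (p. 50)] -/
theorem perc_diagWTB_stepVec_le (κ : Fin d × Bool) :
    diagWTB (Letters.perc d p) (stepVec κ) ≤ ENNReal.ofReal p * wtOpenBubbleAt (Letters.perc d p) (stepVec κ) := by
  refine (perc_diagWTB_le p (stepVec κ)).trans_eq ?_
  rw [perc_tau_eq_one_stepVec]

/-- **The class-`2` right-trivial diagonal, product-bounded**: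
`Σ_ι rawRDiag (P^S−u⃗) Ā^ι ι 2 ≤ p · Σ_y (Σ_ι τ₁(y − e_ι)) · τ₂(y) · Φ(y)`, `Φ(y) = Σ_w ‖w‖₂² τ₁(w) τ₁(w−y)`.
[cite: FitznerVanDerHofstad2017, Lemma 5.1 second version (arXiv:1506.07977v2 p. 50); §4.4 (4.65) (p. 43); §4.2 (4.14)–(4.17) (pp. 35–36)] -/
theorem perc_sum_rawRDiag_two_le :
    ∑ ι : Fin d × Bool, rawRDiag (blockPSn (Letters.perc d p)) (blockAbar' (Letters.perc d p)) ι 2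
      ≤ ENNReal.ofReal p * ∑' y, (∑ ι : Fin d × Bool, (Letters.perc d p).tau (.ge 1) (y - stepVec ι))
          * ((Letters.perc d p).tau (.ge 2) y * wtOpenBubbleAt (Letters.perc d p) y) := by
  rw [sum_rawRDiag_two_eq, ← ENNReal.tsum_mul_left]
  refine ENNReal.tsum_le_tsum fun y => ?_
  calc diagKbar (Letters.perc d p) y * diagWTT (Letters.perc d p) y
        ≤ (ENNReal.ofReal p * ∑ ι : Fin d × Bool, (Letters.perc d p).tau (.ge 1) (y - stepVec ι))
            * ((Letters.perc d p).tau (.ge 2) y * wtOpenBubbleAt (Letters.perc d p) y) :=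
          mul_le_mul' (perc_diagKbar_le p y) (perc_diagWTT_le p y)
    _ = ENNReal.ofReal p * ((∑ ι : Fin d × Bool, (Letters.perc d p).tau (.ge 1) (y - stepVec ι))
            * ((Letters.perc d p).tau (.ge 2) y * wtOpenBubbleAt (Letters.perc d p) y)) := by ring

/-! ## C. Transport over the `2d` directions (`W_d`-invariance) -/

/-- `‖σx‖₂² = ‖x‖₂²` for a signed coordinate permutation `σ`. [cite: FitznerVanDerHofstad2017, §3.5 "Symmetry of the model" (arXiv:1506.07977v2 p. 32)] -/
theorem wt_signedPerm (π : Equiv.Perm (Fin d)) (ε : Fin d → ℤˣ) (x : Site d) :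
    wt (Site.signedPerm π ε x) = wt x := by
  unfold wt Literature.Barriers.CriticalPhenomena.euclidNorm
  have h : ∀ i, (((Site.signedPerm π ε x) i : ℤ) : ℝ) ^ 2 = ((x (π.symm i) : ℤ) : ℝ) ^ 2 := fun i => by
    rw [Site.signedPerm_apply, Int.cast_mul]
    rcases Int.units_eq_one_or (ε i) with hε | hε <;> simp [hε]
  simp_rw [h]
  rw [Equiv.sum_comp π.symm (fun i : Fin d => ((x i : ℤ) : ℝ) ^ 2)]

/-- `τ_j` is `W_d`-invariant. [cite: FitznerVanDerHofstad2017, §3.5 "Symmetry of the model" (arXiv:1506.07977v2 p. 32)] -/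
theorem signedPermInvariant_perc_tau (j : LenIdx) :
    SignedPermInvariant (fun y : Site d => (Letters.perc d p).tau j y) :=
  fun π ε y => perc_tau_signedPerm p π ε j y

/-- The pointwise weighted open bubble `Φ` is `W_d`-invariant (reindex the inner vertex along `σ`).
[cite: FitznerVanDerHofstad2017, §3.5 "Symmetry of the model" (arXiv:1506.07977v2 p. 32); §5.1 "Elements of the bounds" (p. 49)] -/
theorem signedPermInvariant_wtOpenBubbleAt :
    SignedPermInvariant (wtOpenBubbleAt (Letters.perc d p) : Site d → ℝ≥0∞) := by
  intro π ε y
  unfold wtOpenBubbleAt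
  calc ∑' w, wt w * ((Letters.perc d p).tau (.ge 1) w * (Letters.perc d p).tau (.ge 1) (w - Site.signedPerm π ε y))
        = ∑' w, wt (Site.signedPerm π ε w) * ((Letters.perc d p).tau (.ge 1) (Site.signedPerm π ε w)
            * (Letters.perc d p).tau (.ge 1) (Site.signedPerm π ε w - Site.signedPerm π ε y)) :=
          (tsum_signedPerm π ε _).symm
    _ = ∑' w, wt w * ((Letters.perc d p).tau (.ge 1) w * (Letters.perc d p).tau (.ge 1) (w - y)) :=
          tsum_congr fun w => by rw [wt_signedPerm, perc_tau_signedPerm, perc_tau_signedPerm_sub]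

/-- `σ w − σ y = σ (w − y)` (additivity of the signed coordinate permutations). [folklore] -/
private theorem signedPerm_sub_signedPerm (π : Equiv.Perm (Fin d)) (ε : Fin d → ℤˣ) (w y : Site d) :
    Site.signedPerm π ε w - Site.signedPerm π ε y = Site.signedPerm π ε (w - y) := by
  have h := zdSignedPermIso_sub π ε w y
  simp only [zdSignedPermIso_apply] at h
  exact h.symm

/-- `K̄` is `W_d`-invariant (`σ` permutes the `2d` directions of the pivotal bond).
[cite: FitznerVanDerHofstad2017, §3.5 "Symmetry of the model" (arXiv:1506.07977v2 p. 32); §4.2 (4.17) (p. 36)] -/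
theorem signedPermInvariant_perc_diagKbar :
    SignedPermInvariant (diagKbar (Letters.perc d p) : Site d → ℝ≥0∞) := by
  intro π ε y
  unfold diagKbar diagKLetter
  calc ∑ ι : Fin d × Bool, (Letters.perc d p).T (.eq 1) (.ge 1) (.ge 0) (stepVec ι)
          (Site.signedPerm π ε y) (Site.signedPerm π ε y)
        = ∑ ι : Fin d × Bool, (Letters.perc d p).T (.eq 1) (.ge 1) (.ge 0) (Site.signedPerm π ε (stepVec ι))
            (Site.signedPerm π ε y) (Site.signedPerm π ε y) :=
          (sum_stepVec_signedPerm π ε fun e => (Letters.perc d p).T (.eq 1) (.ge 1) (.ge 0) e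
            (Site.signedPerm π ε y) (Site.signedPerm π ε y)).symm
    _ = ∑ ι : Fin d × Bool, (Letters.perc d p).T (.eq 1) (.ge 1) (.ge 0) (stepVec ι) y y :=
          Finset.sum_congr rfl fun ι _ => perc_T_signedPerm p π ε _ _ _ _ _ _

/-- `WTB` is `W_d`-invariant (reindex the weighted vertex along `σ`).
[cite: FitznerVanDerHofstad2017, §3.5 "Symmetry of the model" (arXiv:1506.07977v2 p. 32); §4.2 (4.17) (p. 36)] -/
theorem signedPermInvariant_perc_diagWTB :
    SignedPermInvariant (diagWTB (Letters.perc d p) : Site d → ℝ≥0∞) := by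
  intro π ε y
  unfold diagWTB
  calc ∑' w, wt w * (kdc w 0 * (kdc (w - Site.signedPerm π ε y) 0
          * (Letters.perc d p).T (.ge 1) (.eq 1) (.ge 1) (w - Site.signedPerm π ε y) w 0))
        = ∑' w, wt (Site.signedPerm π ε w) * (kdc (Site.signedPerm π ε w) 0
            * (kdc (Site.signedPerm π ε w - Site.signedPerm π ε y) 0
            * (Letters.perc d p).T (.ge 1) (.eq 1) (.ge 1) (Site.signedPerm π ε w - Site.signedPerm π ε y)
                (Site.signedPerm π ε w) 0)) := (tsum_signedPerm π ε _).symm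
    _ = ∑' w, wt w * (kdc w 0 * (kdc (w - y) 0 * (Letters.perc d p).T (.ge 1) (.eq 1) (.ge 1) (w - y) w 0)) :=
          tsum_congr fun w => by
            have hT : (Letters.perc d p).T (.ge 1) (.eq 1) (.ge 1) (Site.signedPerm π ε (w - y))
                (Site.signedPerm π ε w) 0 = (Letters.perc d p).T (.ge 1) (.eq 1) (.ge 1) (w - y) w 0 := by
              simpa only [Site.signedPerm_zero] using perc_T_signedPerm p π ε (.ge 1) (.eq 1) (.ge 1) (w - y) w 0
            rw [signedPerm_sub_signedPerm, wt_signedPerm, kdc_signedPerm_zero, kdc_signedPerm_zero, hT]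

/-- **The class-`1` right-trivial diagonal, transported to one direction** (an identity at `Letters.perc d p`):
`Σ_ι rawRDiag (P^S−u⃗) Ā^ι ι 1 = 2d · K̄(e_{ι₀}) · WTB(e_{ι₀})` for every direction `ι₀`.
[cite: FitznerVanDerHofstad2017, Lemma 5.1 second version (arXiv:1506.07977v2 p. 50); §4.4 (4.65) (p. 43); §3.5 (p. 32); §6.1 "Case a = 1" (p. 59)] -/
theorem perc_sum_rawRDiag_one_eq (ι₀ : Fin d × Bool) :
    ∑ ι : Fin d × Bool, rawRDiag (blockPSn (Letters.perc d p)) (blockAbar' (Letters.perc d p)) ι 1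
      = (2 * d : ℝ≥0∞) * (diagKbar (Letters.perc d p) (stepVec ι₀) * diagWTB (Letters.perc d p) (stepVec ι₀)) := by
  rw [sum_rawRDiag_one_eq_sum_stepVec,
    ((signedPermInvariant_perc_diagKbar p).mul (signedPermInvariant_perc_diagWTB p)).sum_stepVec_eq ι₀,
    nsmul_eq_mul]
  push_cast
  rfl

/-- **The class-`1` right-trivial diagonal, product-bounded**:
`Σ_ι rawRDiag (P^S−u⃗) Ā^ι ι 1 ≤ 2d · (p Σ_ι τ₁(e_{ι₀} − e_ι)) · (p Φ(e_{ι₀}))` (any `ι₀`; `Φ(e_{ι₀}) =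
Σ_w ‖w‖₂² τ₁(w) τ₁(w − e_{ι₀})`, the weighted closed bubble through the marked bond).
[cite: FitznerVanDerHofstad2017, Lemma 5.1 second version (arXiv:1506.07977v2 p. 50); §4.4 (4.65) (p. 43); §4.2 (4.8), (4.14)–(4.17) (pp. 34–36)] -/
theorem perc_sum_rawRDiag_one_le (ι₀ : Fin d × Bool) :
    ∑ ι : Fin d × Bool, rawRDiag (blockPSn (Letters.perc d p)) (blockAbar' (Letters.perc d p)) ι 1
      ≤ (2 * d : ℝ≥0∞) * ((ENNReal.ofReal p * ∑ ι : Fin d × Bool, (Letters.perc d p).tau (.ge 1) (stepVec ι₀ - stepVec ι))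
          * (ENNReal.ofReal p * wtOpenBubbleAt (Letters.perc d p) (stepVec ι₀))) := by
  rw [perc_sum_rawRDiag_one_eq p ι₀]
  exact mul_le_mul' le_rfl (mul_le_mul' (perc_diagKbar_le p (stepVec ι₀)) (perc_diagWTB_stepVec_le p ι₀))

/-- **Transport over the directions**: for a `W_d`-invariant `G`,
`Σ_y (Σ_ι τ₁(y − e_ι)) G(y) = 2d · Σ_y τ₁(y − e_{ι₀}) G(y)` for every direction `ι₀`.
[cite: FitznerVanDerHofstad2017, §3.5 "Symmetry of the model" (arXiv:1506.07977v2 p. 32); §5.1 "Elements of the bounds" (p. 49)] -/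
theorem perc_tsum_sum_tau_sub_stepVec_mul_eq {G : Site d → ℝ≥0∞} (hG : SignedPermInvariant G)
    (ι₀ : Fin d × Bool) :
    ∑' y, (∑ ι : Fin d × Bool, (Letters.perc d p).tau (.ge 1) (y - stepVec ι)) * G y
      = (2 * d : ℝ≥0∞) * ∑' y, (Letters.perc d p).tau (.ge 1) (y - stepVec ι₀) * G y := by
  have h1 : ∑' y, (∑ ι : Fin d × Bool, (Letters.perc d p).tau (.ge 1) (y - stepVec ι)) * G y
      = ∑ ι : Fin d × Bool, ∑' y, (Letters.perc d p).tau (.ge 1) (y - stepVec ι) * G y := by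
    simp_rw [Finset.sum_mul]
    exact tsum_finsetSum _ _
  have hg : SignedPermInvariant (fun v : Site d => ∑' y, (Letters.perc d p).tau (.ge 1) (y - v) * G y) := by
    intro π ε v
    calc ∑' y, (Letters.perc d p).tau (.ge 1) (y - Site.signedPerm π ε v) * G y
          = ∑' y, (Letters.perc d p).tau (.ge 1) (Site.signedPerm π ε y - Site.signedPerm π ε v)
              * G (Site.signedPerm π ε y) := (tsum_signedPerm π ε _).symm
      _ = ∑' y, (Letters.perc d p).tau (.ge 1) (y - v) * G y :=
            tsum_congr fun y => by rw [perc_tau_signedPerm_sub, hG π ε y]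
  calc ∑' y, (∑ ι : Fin d × Bool, (Letters.perc d p).tau (.ge 1) (y - stepVec ι)) * G y
        = ∑ ι : Fin d × Bool, (fun v : Site d => ∑' y, (Letters.perc d p).tau (.ge 1) (y - v) * G y) (stepVec ι) := h1
    _ = (2 * d) • (fun v : Site d => ∑' y, (Letters.perc d p).tau (.ge 1) (y - v) * G y) (stepVec ι₀) :=
          hg.sum_stepVec_eq ι₀
    _ = (2 * d : ℝ≥0∞) * ∑' y, (Letters.perc d p).tau (.ge 1) (y - stepVec ι₀) * G y := by
          rw [nsmul_eq_mul]
          push_cast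
          rfl

/-- **The class-`2` right-trivial diagonal, product-bounded and transported to one direction**:
`Σ_ι rawRDiag (P^S−u⃗) Ā^ι ι 2 ≤ p · 2d · Σ_y τ₁(y − e_{ι₀}) τ₂(y) Φ(y)` (any `ι₀`).
[cite: FitznerVanDerHofstad2017, Lemma 5.1 second version (arXiv:1506.07977v2 p. 50); §4.4 (4.65) (p. 43); §3.5 (p. 32)] -/
theorem perc_sum_rawRDiag_two_le_dir (ι₀ : Fin d × Bool) :
    ∑ ι : Fin d × Bool, rawRDiag (blockPSn (Letters.perc d p)) (blockAbar' (Letters.perc d p)) ι 2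
      ≤ ENNReal.ofReal p * ((2 * d : ℝ≥0∞) * ∑' y, (Letters.perc d p).tau (.ge 1) (y - stepVec ι₀)
          * ((Letters.perc d p).tau (.ge 2) y * wtOpenBubbleAt (Letters.perc d p) y)) := by
  refine (perc_sum_rawRDiag_two_le p).trans_eq ?_
  rw [perc_tsum_sum_tau_sub_stepVec_mul_eq p
    ((signedPermInvariant_perc_tau p (.ge 2)).mul (signedPermInvariant_wtOpenBubbleAt p)) ι₀]

end Perc

end Literature.Probability.FitznerVanDerHofstad2017

end
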